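import Literature.NumberTheory.Sieve.Maynard2016CoupledLocal

/-!
# Maynard (2016), Lemma 6: the coupled kernel as `E · N · Z · Z'` ((6.11)–(6.16))

Trunk: AntSieve / parity (Maynard 2016 large-gaps ladder, named fact
`Literature.NumberTheory.Sieve.Maynard2016.Lemma6MainTerm` of `Maynard2016Lemma6Split.lean`).

J. Maynard, *Large gaps between primes*, Ann. of Math. 183 (2016) = arXiv:1408.5110, §6, proof of
Lemma 6, p. 10, displays (6.11)–(6.16): the coupled kernel `K = ∏_{p ∤ W} K_p`
(`LcmEuler.tendsto_prod_coupledLocalFactorMu`) is factorised, using the local comparison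
`K_p = (1 + η_p) B_p(s,s') B_p(r,r') (1 + ν_p/p)` of `Maynard2016CoupledLocal.lean`, as
`K = E · N · Z(s,s') · Z(r,r')` with
* `E = ∏_{p ∤ W} (1 + η_p)` (`LcmEuler.coupledEpsProd`), the factor that is `1 + o(1)` by (6.12)–(6.14):
  PROVED here `‖E − 1‖ ≤ exp(T) − 1`, `T = 6^{k+k'} (2 C₂(k,k')/p₀ + 16(k'+kk') τ Σ_{p ∈ Bad} log p/p)`
  (`LcmEuler.norm_coupledEpsProd_sub_one_le`), where every prime `∤ W` is `≥ p₀` and `Bad` contains the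
  primes `p ∤ W` with `p ∣ m` or `M_p ≠ ∅`;
* `N = ∏_{p ∈ Bad, p ∤ W} (1 + ν_p/p)` (`LcmEuler.nuProd`), the arithmetic factor
  `∏_{w < p ≤ y} (1 − (ω_{m,q}(p) − 2k)/p)` of (6.16) (independent of the Fourier variables);
* `Z(s,s') = ∏_ℓ ζ_W(1+s_ℓ+s'_ℓ)/(ζ_W(1+s_ℓ) ζ_W(1+s'_ℓ))` (`LcmEuler.zetaLimit`, Polymath 8b) on each side.
Main results: `LcmEuler.coupledKernel_eq_prod` (the factorisation), `LcmEuler.norm_coupledEpsProd_le`,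
`LcmEuler.norm_coupledEpsProd_sub_one_le`.

## References

* J. Maynard, *Large gaps between primes*, Ann. of Math. (2) 183 (2016), 915–933; arXiv:1408.5110,
  §6, proof of Lemma 6, displays (6.11)–(6.16). [Maynard2016LargeGaps]
* D. H. J. Polymath, *Variants of the Selberg sieve, and bounded intervals containing many primes*,
  Res. Math. Sci. 1 (2014), Art. 12; arXiv:1407.4897, proof of Lemma 4.1, p. 12. [Polymath8b2014]
-/

noncomputable section

open Filter Finset
open scoped BigOperators Topology Classical

namespace Literature.NumberTheory.Sieve

namespace LcmEuler

variable {ι κ : Type*} [Fintype ι] [Fintype κ]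

/-! ### Definitions -/

/-- `η'_n := η_n` at primes `n ∤ W`, `0` otherwise. [cite: Maynard2016LargeGaps, §6 displays (6.12)–(6.13)] -/
def coupledEpsSeq (W m : ℕ) (M : ℕ → Finset (ι × κ)) (a b : ι → ℂ) (a' b' : κ → ℂ) (n : ℕ) : ℂ :=
  if n.Prime ∧ ¬ n ∣ W then coupledEps m M a b a' b' n else 0

/-- **`E := ∏_{p ∤ W} (1 + η_p)`**, the `1 + o(1)` factor of (6.12)–(6.14). [cite: Maynard2016LargeGaps, §6 display (6.14)] -/
def coupledEpsProd (W m : ℕ) (M : ℕ → Finset (ι × κ)) (a b : ι → ℂ) (a' b' : κ → ℂ) : ℂ :=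
  ∏' n : ℕ, (1 + coupledEpsSeq W m M a b a' b' n)

/-- **`N := ∏_{p ∈ Bad, p prime, p ∤ W} (1 + ν_p/p)`** — the factor `∏ (1 − (ω_{m,q}(p) − 2k)/p)` of (6.16).
[cite: Maynard2016LargeGaps, §6 display (6.16)] -/
def nuProd (W m : ℕ) (M : ℕ → Finset (ι × κ)) (Bad : Finset ℕ) : ℂ :=
  ∏ q ∈ Bad.filter (fun q => q.Prime ∧ ¬ q ∣ W), (1 + (coupledNu m M q : ℂ) / q)

/-- The total `T = 6^{k+k'} (2 C₂/p₀ + 16(k'+kk') τ Σ_{p ∈ Bad} log p/p)` bounding `Σ_p |η_p|`.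
[cite: Maynard2016LargeGaps, §6 display (6.14)] -/
def epsTotal (k k' p₀ : ℕ) (τ : ℝ) (Bad : Finset ℕ) : ℝ :=
  6 ^ (k + k') * (2 * badConst k k' / p₀ + 16 * (k' + k * k') * (τ * ∑ p ∈ Bad, Real.log p / p))

section Bounds

variable {W m : ℕ} {M : ℕ → Finset (ι × κ)} {a b : ι → ℂ} {a' b' : κ → ℂ}
  (hab : ∀ i, 0 ≤ (a i).re ∧ 0 ≤ (b i).re) (hab' : ∀ j, 0 ≤ (a' j).re ∧ 0 ≤ (b' j).re)
  {p₀ : ℕ} (hp₀ : 2 ≤ p₀) (hp₀k : 7 * Fintype.card ι ≤ p₀) (hp₀k' : 7 * Fintype.card κ ≤ p₀)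
  (hWp : ∀ q : ℕ, q.Prime → ¬ q ∣ W → p₀ ≤ q)
  {τ : ℝ} (hτ0 : 0 ≤ τ) (ha : ∀ i, ‖a i‖ ≤ τ) (ha' : ∀ j, ‖a' j‖ ≤ τ)
  {Bad : Finset ℕ} (hBad : ∀ q : ℕ, q.Prime → ¬ q ∣ W → q ∉ Bad → ¬ q ∣ m ∧ M q = ∅)

omit [Fintype ι] [Fintype κ] in
/-- `C₁ ≤ C₂`. [folklore] -/
private theorem goodConst_le_badConst (k k' : ℕ) : goodConst k k' ≤ badConst k k' := by
  have h : (0 : ℝ) ≤ 12 * (k' : ℝ) ^ 2 + 8 * (49 * (k' : ℝ) ^ 2 + 8 * k') +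
      k * k' * (6 * k + 3 * k' + 2 * (49 * (k : ℝ) ^ 2 + 8 * k) + 4 * (49 * (k' : ℝ) ^ 2 + 8 * k')) := by
    positivity
  unfold badConst; linarith

include hab hab' hp₀k hp₀k' hWp hτ0 ha ha' hBad in
/-- **Pointwise bound**: `|η'_n| ≤ [p₀ ≤ n] 6^{k+k'} C₂/n² + [n ∈ Bad] 6^{k+k'} 16(k'+kk') τ log n/n`.
[cite: Maynard2016LargeGaps, §6 displays (6.12)–(6.13)] -/
theorem norm_coupledEpsSeq_le (n : ℕ) :
    ‖coupledEpsSeq W m M a b a' b' n‖ ≤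
      (if p₀ ≤ n then 6 ^ (Fintype.card ι + Fintype.card κ) *
          (badConst (Fintype.card ι) (Fintype.card κ) / (n : ℝ) ^ 2) else 0) +
        (if n ∈ Bad then 6 ^ (Fintype.card ι + Fintype.card κ) *
          (16 * (Fintype.card κ + Fintype.card ι * Fintype.card κ) * (τ * Real.log n) / n) else 0) := by
  have hB := badConst_nonneg (Fintype.card ι) (Fintype.card κ)
  have h2nd : 0 ≤ (if n ∈ Bad then 6 ^ (Fintype.card ι + Fintype.card κ) *
      (16 * (Fintype.card κ + Fintype.card ι * Fintype.card κ) * (τ * Real.log n) / n) else (0 : ℝ)) := by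
    split_ifs
    · have : 0 ≤ Real.log n := by
        rcases Nat.eq_zero_or_pos n with h | h
        · simp [h]
        · exact Real.log_nonneg (by exact_mod_cast h)
      positivity
    · exact le_rfl
  have h1st : 0 ≤ (if p₀ ≤ n then 6 ^ (Fintype.card ι + Fintype.card κ) *
      (badConst (Fintype.card ι) (Fintype.card κ) / (n : ℝ) ^ 2) else (0 : ℝ)) := by
    split_ifs <;> positivity
  unfold coupledEpsSeq
  by_cases hn : n.Prime ∧ ¬ n ∣ W
  · rw [if_pos hn]
    have hpn : p₀ ≤ n := hWp n hn.1 hn.2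
    rw [if_pos hpn]
    have hnk : 7 * Fintype.card ι ≤ n := hp₀k.trans hpn
    have hnk' : 7 * Fintype.card κ ≤ n := hp₀k'.trans hpn
    by_cases hnB : n ∈ Bad
    · rw [if_pos hnB, ← mul_add]
      exact norm_coupledEps_le hab hab' hn.1 hnk hnk' hτ0 ha ha'
    · rw [if_neg hnB, add_zero]
      obtain ⟨hnm, hM⟩ := hBad n hn.1 hn.2 hnB
      refine (norm_coupledEps_le_of_good hab hab' hn.1 hnk hnk' hnm hM).trans ?_
      gcongr
      exact goodConst_le_badConst _ _
  · rw [if_neg hn, norm_zero]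
    exact add_nonneg h1st h2nd

include hab hab' hp₀ hp₀k hp₀k' hWp hτ0 ha ha' hBad in
/-- **Partial sums of `|η'_n|` are at most `T`** ("`∏_{p>w}(1+O(p^{-2})) · ∏_{bad}(1+O(…)) = exp(O(w^{-1} + …))`").
[cite: Maynard2016LargeGaps, §6 display (6.14)] -/
theorem sum_norm_coupledEpsSeq_le (s : Finset ℕ) :
    ∑ n ∈ s, ‖coupledEpsSeq W m M a b a' b' n‖ ≤
      epsTotal (Fintype.card ι) (Fintype.card κ) p₀ τ Bad := by
  set k := Fintype.card ι
  set k' := Fintype.card κ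
  set C : ℝ := 6 ^ (k + k') * badConst k k'
  set D : ℝ := 6 ^ (k + k') * (16 * (k' + k * k') * τ)
  have hC : 0 ≤ C := by have := badConst_nonneg k k'; positivity
  have hD : 0 ≤ D := by positivity
  have hlog : ∀ n : ℕ, 0 ≤ Real.log n := fun n => by
    rcases Nat.eq_zero_or_pos n with h | h
    · simp [h]
    · exact Real.log_nonneg (by exact_mod_cast h)
  -- first part: `∑_{n ∈ s, p₀ ≤ n} C/n² ≤ 2C/p₀`
  set N := s.sup id + 1 with hN
  have hsub : s.filter (fun n => p₀ ≤ n) ⊆ Finset.Ioo (p₀ - 1) N := by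
    intro n hn
    rw [Finset.mem_filter] at hn
    rw [Finset.mem_Ioo]
    have : n ≤ s.sup id := Finset.le_sup (f := id) hn.1
    omega
  have hA : ∑ n ∈ s, (if p₀ ≤ n then C / (n : ℝ) ^ 2 else 0) ≤ 2 * C / p₀ := by
    calc ∑ n ∈ s, (if p₀ ≤ n then C / (n : ℝ) ^ 2 else 0)
        = ∑ n ∈ s.filter (fun n => p₀ ≤ n), C / (n : ℝ) ^ 2 := by rw [Finset.sum_filter]
      _ ≤ ∑ n ∈ Finset.Ioo (p₀ - 1) N, C / (n : ℝ) ^ 2 :=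
          Finset.sum_le_sum_of_subset_of_nonneg hsub fun n _ _ => by positivity
      _ = C * ∑ n ∈ Finset.Ioo (p₀ - 1) N, ((n : ℝ) ^ 2)⁻¹ := by
          rw [Finset.mul_sum]; exact Finset.sum_congr rfl fun n _ => by rw [div_eq_mul_inv]
      _ ≤ C * (2 / ((p₀ - 1 : ℕ) + 1)) := mul_le_mul_of_nonneg_left (sum_Ioo_inv_sq_le _ _) hC
      _ = 2 * C / p₀ := by
          have : ((p₀ - 1 : ℕ) : ℝ) + 1 = p₀ := by
            rw [Nat.cast_sub (by omega : 1 ≤ p₀)]; push_cast; ring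
          rw [this]; ring
  -- second part: `∑_{n ∈ s ∩ Bad} D log n/n ≤ D ∑_{p ∈ Bad} log p/p`
  have hBsum : ∑ n ∈ s, (if n ∈ Bad then D * Real.log n / n else 0) ≤
      D * ∑ p ∈ Bad, Real.log p / p := by
    rw [← Finset.sum_filter]
    have hsub' : s.filter (fun n => n ∈ Bad) ⊆ Bad := fun n hn => (Finset.mem_filter.1 hn).2
    calc ∑ n ∈ s.filter (fun n => n ∈ Bad), D * Real.log n / n
        ≤ ∑ n ∈ Bad, D * Real.log n / n := Finset.sum_le_sum_of_subset_of_nonneg hsub'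
          fun n _ _ => div_nonneg (mul_nonneg hD (hlog n)) (Nat.cast_nonneg n)
      _ = D * ∑ p ∈ Bad, Real.log p / p := by
          rw [Finset.mul_sum]; exact Finset.sum_congr rfl fun n _ => by ring
  calc ∑ n ∈ s, ‖coupledEpsSeq W m M a b a' b' n‖
      ≤ ∑ n ∈ s, ((if p₀ ≤ n then C / (n : ℝ) ^ 2 else 0) +
          (if n ∈ Bad then D * Real.log n / n else 0)) := by
        refine Finset.sum_le_sum fun n _ => (norm_coupledEpsSeq_le hab hab' hp₀k hp₀k' hWp hτ0 ha ha' hBad n).trans (le_of_eq ?_)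
        congr 1
        · split_ifs <;> ring
        · split_ifs <;> ring
    _ = (∑ n ∈ s, (if p₀ ≤ n then C / (n : ℝ) ^ 2 else 0)) +
          ∑ n ∈ s, (if n ∈ Bad then D * Real.log n / n else 0) := Finset.sum_add_distrib
    _ ≤ 2 * C / p₀ + D * ∑ p ∈ Bad, Real.log p / p := add_le_add hA hBsum
    _ = epsTotal k k' p₀ τ Bad := by simp only [epsTotal, C, D]; ring

include hab hab' hp₀ hp₀k hp₀k' hWp hτ0 ha ha' hBad in
/-- `∑ |η'_n| < ∞`. [cite: Maynard2016LargeGaps, §6 display (6.14)] -/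
theorem summable_norm_coupledEpsSeq : Summable fun n => ‖coupledEpsSeq W m M a b a' b' n‖ :=
  summable_of_sum_le (fun _ => norm_nonneg _)
    (sum_norm_coupledEpsSeq_le hab hab' hp₀ hp₀k hp₀k' hWp hτ0 ha ha' hBad)

include hab hab' hp₀ hp₀k hp₀k' hWp hτ0 ha ha' hBad in
/-- The partial products `∏_{p < N, p ∤ W} (1 + η_p)` tend to `E`. [cite: Maynard2016LargeGaps, §6 display (6.14)] -/
theorem tendsto_prod_one_add_coupledEps :
    Tendsto (fun N : ℕ => ∏ q ∈ primesBelowNotDvd W N, (1 + coupledEps m M a b a' b' q)) atTop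
      (𝓝 (coupledEpsProd W m M a b a' b')) := by
  have hmul : Multipliable fun n => 1 + coupledEpsSeq W m M a b a' b' n :=
    Complex.multipliable_one_add_of_summable
      (summable_norm_coupledEpsSeq hab hab' hp₀ hp₀k hp₀k' hWp hτ0 ha ha' hBad).of_norm
  have h := hmul.hasProd.tendsto_prod_nat
  refine h.congr fun N => ?_
  rw [primesBelowNotDvd, Nat.primesBelow, Finset.filter_filter, Finset.prod_filter]
  refine Finset.prod_congr rfl fun n _ => ?_
  unfold coupledEpsSeq
  split_ifs <;> simp

include hab hab' hp₀ hp₀k hp₀k' hWp hτ0 ha ha' hBad in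
/-- `‖∏_{p < N, p ∤ W} (1 + η_p)‖ ≤ exp(T)`. [cite: Maynard2016LargeGaps, §6 display (6.14)] -/
theorem norm_prod_one_add_coupledEps_le (N : ℕ) :
    ‖∏ q ∈ primesBelowNotDvd W N, (1 + coupledEps m M a b a' b' q)‖ ≤
      Real.exp (epsTotal (Fintype.card ι) (Fintype.card κ) p₀ τ Bad) := by
  refine (norm_prod_one_add_le_exp _ _).trans (Real.exp_le_exp.2 ?_)
  have h := sum_norm_coupledEpsSeq_le hab hab' hp₀ hp₀k hp₀k' hWp hτ0 ha ha' hBad (primesBelowNotDvd W N)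
  refine le_trans (le_of_eq ?_) h
  refine Finset.sum_congr rfl fun q hq => ?_
  rw [coupledEpsSeq, if_pos ⟨prime_of_mem_primesBelowNotDvd hq, not_dvd_of_mem_primesBelowNotDvd hq⟩]

include hab hab' hp₀ hp₀k hp₀k' hWp hτ0 ha ha' hBad in
/-- `‖∏_{p < N, p ∤ W} (1 + η_p) − 1‖ ≤ exp(T) − 1`. [cite: Maynard2016LargeGaps, §6 display (6.14)] -/
theorem norm_prod_one_add_coupledEps_sub_one_le (N : ℕ) :
    ‖∏ q ∈ primesBelowNotDvd W N, (1 + coupledEps m M a b a' b' q) - 1‖ ≤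
      Real.exp (epsTotal (Fintype.card ι) (Fintype.card κ) p₀ τ Bad) - 1 := by
  refine (Finset.norm_prod_one_add_sub_one_le _ _).trans ?_
  have h := sum_norm_coupledEpsSeq_le hab hab' hp₀ hp₀k hp₀k' hWp hτ0 ha ha' hBad (primesBelowNotDvd W N)
  have h' : ∑ q ∈ primesBelowNotDvd W N, ‖coupledEps m M a b a' b' q‖ =
      ∑ q ∈ primesBelowNotDvd W N, ‖coupledEpsSeq W m M a b a' b' q‖ :=
    Finset.sum_congr rfl fun q hq => by
      rw [coupledEpsSeq, if_pos ⟨prime_of_mem_primesBelowNotDvd hq, not_dvd_of_mem_primesBelowNotDvd hq⟩]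
  rw [h']
  linarith [Real.exp_le_exp.2 h]

include hab hab' hp₀ hp₀k hp₀k' hWp hτ0 ha ha' hBad in
/-- **`‖E‖ ≤ exp(T)`**. [cite: Maynard2016LargeGaps, §6 display (6.14)] -/
theorem norm_coupledEpsProd_le :
    ‖coupledEpsProd W m M a b a' b'‖ ≤ Real.exp (epsTotal (Fintype.card ι) (Fintype.card κ) p₀ τ Bad) :=
  le_of_tendsto' ((continuous_norm.tendsto _).comp
    (tendsto_prod_one_add_coupledEps hab hab' hp₀ hp₀k hp₀k' hWp hτ0 ha ha' hBad))
    fun N => norm_prod_one_add_coupledEps_le hab hab' hp₀ hp₀k hp₀k' hWp hτ0 ha ha' hBad N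

include hab hab' hp₀ hp₀k hp₀k' hWp hτ0 ha ha' hBad in
/-- **`‖E − 1‖ ≤ exp(T) − 1`** — (6.14): `E = 1 + o(1)` as soon as `T → 0`.
[cite: Maynard2016LargeGaps, §6 display (6.14)] -/
theorem norm_coupledEpsProd_sub_one_le :
    ‖coupledEpsProd W m M a b a' b' - 1‖ ≤
      Real.exp (epsTotal (Fintype.card ι) (Fintype.card κ) p₀ τ Bad) - 1 :=
  le_of_tendsto' ((continuous_norm.tendsto _).comp
    ((tendsto_prod_one_add_coupledEps hab hab' hp₀ hp₀k hp₀k' hWp hτ0 ha ha' hBad).sub_const 1))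
    fun N => norm_prod_one_add_coupledEps_sub_one_le hab hab' hp₀ hp₀k hp₀k' hWp hτ0 ha ha' hBad N

end Bounds

/-! ### The arithmetic factor `N` -/

omit [Fintype ι] in
/-- Off `Bad`, `ν_p = 0`. [cite: Maynard2016LargeGaps, §6 display (6.16)] -/
theorem coupledNu_eq_zero {W m : ℕ} {M : ℕ → Finset (ι × κ)} {Bad : Finset ℕ}
    (hBad : ∀ q : ℕ, q.Prime → ¬ q ∣ W → q ∉ Bad → ¬ q ∣ m ∧ M q = ∅) {q : ℕ} (hq : q.Prime)
    (hqW : ¬ q ∣ W) (hqB : q ∉ Bad) : coupledNu m M q = 0 := by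
  obtain ⟨hqm, hM⟩ := hBad q hq hqW hqB
  simp [coupledNu, hqm, hM]

omit [Fintype ι] in
/-- For `N > max Bad` the partial product `∏_{p < N, p ∤ W} (1 + ν_p/p)` is `N`. [cite: Maynard2016LargeGaps, §6 display (6.16)] -/
theorem prod_one_add_coupledNu_div_eq {W m : ℕ} {M : ℕ → Finset (ι × κ)} {Bad : Finset ℕ}
    (hBad : ∀ q : ℕ, q.Prime → ¬ q ∣ W → q ∉ Bad → ¬ q ∣ m ∧ M q = ∅) {N : ℕ}
    (hN : ∀ q ∈ Bad, q < N) :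
    ∏ q ∈ primesBelowNotDvd W N, (1 + (coupledNu m M q : ℂ) / q) = nuProd W m M Bad := by
  unfold nuProd
  have hsub : Bad.filter (fun q => q.Prime ∧ ¬ q ∣ W) ⊆ primesBelowNotDvd W N := by
    intro q hq
    obtain ⟨hqB, hqp, hqW⟩ := Finset.mem_filter.1 hq
    exact Finset.mem_filter.2 ⟨Nat.mem_primesBelow.2 ⟨hN q hqB, hqp⟩, hqW⟩
  refine (Finset.prod_subset hsub fun q hq hq' => ?_).symm
  have hqp := prime_of_mem_primesBelowNotDvd hq
  have hqW := not_dvd_of_mem_primesBelowNotDvd hq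
  have hqB : q ∉ Bad := fun h => hq' (Finset.mem_filter.2 ⟨h, hqp, hqW⟩)
  rw [coupledNu_eq_zero hBad hqp hqW hqB]
  simp

/-! ### `K = E · N · Z(s,s') · Z(r,r')` -/

/-- **The coupled kernel against `ζ`** ((6.11)–(6.16)): for `W ≠ 0`, exponents of real part `≥ σ > 0`
and norm `≤ τ`, every prime `∤ W` at least `p₀ ≥ 7k, 7k'`, and a finite set `Bad` outside which
`p ∤ m` and `M_p = ∅`:
`K = E · N · ∏_ℓ ζ_W(1+s_ℓ+s'_ℓ)/(ζ_W(1+s_ℓ)ζ_W(1+s'_ℓ)) · ∏_ℓ ζ_W(1+r_ℓ+r'_ℓ)/(ζ_W(1+r_ℓ)ζ_W(1+r'_ℓ))`.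
[cite: Maynard2016LargeGaps, §6 display (6.16)] -/
theorem coupledKernel_eq_prod {W m : ℕ} (hW : W ≠ 0) (M : ℕ → Finset (ι × κ)) {a b : ι → ℂ}
    {a' b' : κ → ℂ} {σ : ℝ} (hσ : 0 < σ) (habσ : ∀ i, σ ≤ (a i).re ∧ σ ≤ (b i).re)
    (hab'σ : ∀ j, σ ≤ (a' j).re ∧ σ ≤ (b' j).re) {p₀ : ℕ} (hp₀ : 2 ≤ p₀)
    (hp₀k : 7 * Fintype.card ι ≤ p₀) (hp₀k' : 7 * Fintype.card κ ≤ p₀)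
    (hWp : ∀ q : ℕ, q.Prime → ¬ q ∣ W → p₀ ≤ q) {τ : ℝ} (hτ0 : 0 ≤ τ) (ha : ∀ i, ‖a i‖ ≤ τ)
    (ha' : ∀ j, ‖a' j‖ ≤ τ) {Bad : Finset ℕ}
    (hBad : ∀ q : ℕ, q.Prime → ¬ q ∣ W → q ∉ Bad → ¬ q ∣ m ∧ M q = ∅) :
    coupledKernel W m M a b a' b' =
      coupledEpsProd W m M a b a' b' * nuProd W m M Bad * (zetaLimit W a b * zetaLimit W a' b') := by
  have hab : ∀ i, 0 ≤ (a i).re ∧ 0 ≤ (b i).re := fun i =>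
    ⟨hσ.le.trans (habσ i).1, hσ.le.trans (habσ i).2⟩
  have hab' : ∀ j, 0 ≤ (a' j).re ∧ 0 ≤ (b' j).re := fun j =>
    ⟨hσ.le.trans (hab'σ j).1, hσ.le.trans (hab'σ j).2⟩
  have habp : ∀ i, 0 < (a i).re ∧ 0 < (b i).re := fun i =>
    ⟨hσ.trans_le (habσ i).1, hσ.trans_le (habσ i).2⟩
  have hab'p : ∀ j, 0 < (a' j).re ∧ 0 < (b' j).re := fun j =>
    ⟨hσ.trans_le (hab'σ j).1, hσ.trans_le (hab'σ j).2⟩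
  have h1 := tendsto_prod_coupledLocalFactorMu (W := W) (m := m) M hσ habσ hab'σ
  have heq : (fun N : ℕ => ∏ q ∈ primesBelowNotDvd W N, coupledLocalFactorMu m M a b a' b' q) =
      fun N => (∏ q ∈ primesBelowNotDvd W N, (1 + coupledEps m M a b a' b' q)) *
        (∏ q ∈ primesBelowNotDvd W N, (1 + (coupledNu m M q : ℂ) / q)) *
        ((∏ q ∈ primesBelowNotDvd W N, zetaFactor a b q) *
          ∏ q ∈ primesBelowNotDvd W N, zetaFactor a' b' q) := by
    funext N
    rw [← Finset.prod_mul_distrib, ← Finset.prod_mul_distrib, ← Finset.prod_mul_distrib]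
    exact Finset.prod_congr rfl fun q hq => by
      rw [coupledLocalFactorMu_eq_mul hab hab' (prime_of_mem_primesBelowNotDvd hq).two_le]; ring
  rw [heq] at h1
  have hE := tendsto_prod_one_add_coupledEps hab hab' hp₀ hp₀k hp₀k' hWp hτ0 ha ha' hBad
  have hN : Tendsto (fun N : ℕ => ∏ q ∈ primesBelowNotDvd W N, (1 + (coupledNu m M q : ℂ) / q))
      atTop (𝓝 (nuProd W m M Bad)) := by
    refine tendsto_const_nhds.congr' ?_
    filter_upwards [eventually_gt_atTop (Bad.sup id)] with N hN
    exact (prod_one_add_coupledNu_div_eq hBad fun q hq =>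
      lt_of_le_of_lt (Finset.le_sup (f := id) hq) hN).symm
  have hZ := tendsto_prod_zetaFactor hW habp
  have hZ' := tendsto_prod_zetaFactor hW hab'p
  exact tendsto_nhds_unique h1 ((hE.mul hN).mul (hZ.mul hZ'))

end LcmEuler

end Literature.NumberTheory.Sieve

end
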